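import Literature.AlgebraicGeometry.HodgeTheory.SupportFamilyFibreDimensionLocus
import Literature.AlgebraicGeometry.HodgeTheory.AlgebraicityLocusCurves
import Literature.AlgebraicGeometry.HodgeTheory.IsoTransport
import Literature.AlgebraicGeometry.HodgeTheory.GenericFibreClosedSubsetSpread
import Literature.AlgebraicGeometry.HodgeTheory.GysinFormalismCorrespondences
import HarnessLib

/-!
# Slices of a closed subset of a pulled-back family: the codimension condition is open, and
# transport of death and codimension along the fibre identifications

Topic `Literature/AlgebraicGeometry/HodgeTheory` (family `hodge`). Theorems only (no definition, no
named fact; D-0026). Setting: a cartesian square of `ℂ`-schemes `(q, g; f, h)` — `f : 𝒳 ⟶ S` a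
proper family, `h : T ⟶ S` a parameter scheme, `g : 𝒲 = 𝒳 ×_S T ⟶ T` the pulled-back family,
`q : 𝒲 ⟶ 𝒳` — a closed subset `Z ⊆ 𝒲` (a family of supports parametrised by `T`) and a class
`A ∈ Hⁱ(𝒳(ℂ); ℂ)`. For a complex point `y` of `T` the fibre `𝒲_y` is identified with
`𝒳_{h(y)}` (`exists_fiberOver_iso_of_isPullback`, Görtz–Wedhorn I, Prop. 4.16), the slice
`Z_y = ι_y⁻¹ Z ⊆ 𝒲_y` with a closed subset of `𝒳_{h(y)}`, and `(q^* A)|_{𝒲_y}` with `A|_{𝒳_{h(y)}}`.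

* `exists_opens_pt_mem_iff_forall_height_fiber_add_le` — for `𝒳` with a preimmersion
  `ε : 𝒳 ⟶ ℙᴺ` and `S → Spec ℂ` separated: **the set of complex points `y` of `T` whose slice
  `Z_y` has all its points of dimension `≤ n - p` is (the trace of) a Zariski OPEN subset of `T`**
  — the tree's `exists_opens_pt_mem_iff_forall_height_add_le` (projective dimension theorem in
  the fibres; Hartshorne I Thm. 7.2, EGA IV₃ 13.1.5) for the closed image of `Z` under the proper
  map `𝒲 → 𝒳 × T`, whose slices are the `Z_y`.
* `map_fiberι_map_eq_map_of_fiberIso` — `(q^* A)|_{𝒲_y} = φ^* (A|_{𝒳_{h y}})` for a fibre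
  identification `φ : 𝒲_y ≅ 𝒳_{h(y)}` compatible with the inclusions.
* `map_fiberι_mem_algebraicClasses_of_slice` — **if `(q^* A)|_{𝒲_y}` dies off `Z_y` and `Z_y` has
  codimension `≥ p`, then `A|_{𝒳_{h(y)}}` is algebraic** (fibres smooth projective of dimension `n`).
* `restrictCompl_map_fiberι_map_eq_zero_of_fiberIso`, `forall_height_add_le_of_fiberIso` — the
  converse transport at ONE point: death of `A|_{𝒳_s}` off `V` and codimension `≥ p` of `V` give
  death of `(q^* A)|_{𝒲_t}` off the slice `Z_t = e⁻¹ V` and the dimension bound on `Z_t`, for a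
  fibre identification `e : 𝒲_t ≅ 𝒳_s` carrying `Z_t` to `V`.

These are the bookkeeping steps of the spreading argument for the variational Hodge conjecture
(Voisin, *Hodge Theory II*, §3.3.1; Charles–Schnell 2014, proof of Prop. 11.3.11): the support
of `A|_{𝒳_s}` is spread to `Z ⊆ 𝒳 ×_S T`, and algebraicity of `A` on the fibres over the image of
a neighbourhood of the spread point is read off the slices of `Z`.

## References

* [VoisinHodgeII2003] C. Voisin, Hodge Theory and Complex Algebraic Geometry II (2003), §3.3.1.
* [CharlesSchnell2014Notes] F. Charles, C. Schnell, Notes on absolute Hodge classes (2014),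
  Prop. 11.3.11 (proof).
* [Hartshorne1977] R. Hartshorne, Algebraic Geometry (1977), I Thm. 7.2, II Ex. 3.22.
* [GortzWedhorn2020] U. Görtz, T. Wedhorn, Algebraic Geometry I (2nd ed. 2020), Prop. 4.16.
-/

noncomputable section

open CategoryTheory CategoryTheory.Limits AlgebraicGeometry TopologicalSpace Set Order
open MonoidalCategory CartesianMonoidalCategory
open Literature.AlgebraicGeometry.Motives

namespace Literature.AlgebraicGeometry.HodgeTheory

section HodgeTheory

variable {𝒳 S T 𝒲 : Motives.SchemeOver ℂ} (f : 𝒳 ⟶ S) (h : T ⟶ S) (q : 𝒲 ⟶ 𝒳) (g : 𝒲 ⟶ T)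

/-! ### Points of a fibre lie over the complex point -/

/-- A point of the fibre `𝒲_y` maps to the point of `T` under `y` (a copy of
`apply_fiberι_base_eq_pt` of `SpreadSupportsSpreadSet`, whose imports are unrelated). [folklore] -/
private theorem apply_fiberι_base_eq_pt' (y : Motives.ComplexPoints T) (z : (Motives.fiberOver g y).left) :
    g.left.base ((Motives.fiberι g y).left.base z) = y.pt := by
  have h := congrArg (fun φ => φ.left.base z) (Motives.fiberι_comp g y)
  simp only [Over.comp_left, Scheme.Hom.comp_base, TopCat.coe_comp, Function.comp_apply] at h
  rw [h]
  change y.left.base _ = y.left.base (IsLocalRing.closedPoint ℂ)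
  exact congrArg y.left.base (Subsingleton.elim (α := PrimeSpectrum ℂ) _ _)

omit q g in
/-- `pr₁ (i_y x) = x` for the slice `i_y : 𝒳 ⟶ 𝒳 × T` (a copy of `fst_sliceAt_base` of
`AlgebraicClassesFibreRestriction`, not imported here). [folklore] -/
private theorem fst_sliceAt_base' (y : Motives.ComplexPoints T) (x : 𝒳.left) :
    (fst 𝒳 T).left.base ((sliceAt 𝒳 y).left.base x) = x := by
  change (sliceAt 𝒳 y ≫ fst 𝒳 T).left.base x = x
  rw [sliceAt_fst]
  rfl

/-! ### The codimension condition on the slices is open -/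

/-- **The codimension condition on the slices of a closed subset of a pulled-back family is open,
with an explicit open set.** Let `(q, g; f, h)` be a cartesian square of `ℂ`-schemes with
`f : 𝒳 ⟶ S` proper, `S` separated and locally of finite type over `ℂ`, `T` locally of finite type,
`ε : 𝒳 ⟶ ℙᴺ` a preimmersion, and `Z ⊆ 𝒲` closed. For `p n : ℕ` there is an open `O ⊆ T` whose
complex points are exactly the `y` such that every point `z` of the slice `ι_y⁻¹ Z ⊆ 𝒲_y` has
`height z + p ≤ n` (for fibres smooth projective of dimension `n`: the slice has codimension
`≥ p`). Proof: the map `m = (q, g) : 𝒲 ⟶ 𝒳 × T` is proper (`g` is, and `𝒳 × T → T` is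
separated), so `m(Z)` is closed; its slice over `y` through `i_y : 𝒳 ≅ 𝒳 × {y}` is the image of
`ι_y⁻¹ Z` under the closed immersion `𝒲_y ≅ 𝒳_{h y} ↪ 𝒳`, which preserves heights; apply
`exists_opens_pt_mem_iff_forall_height_add_le`. [cite: Hartshorne1977, I Thm. 7.2 and II Ex. 3.22]
[cite: CharlesSchnell2014Notes, Prop. 11.3.11 (proof)] -/
theorem exists_opens_pt_mem_iff_forall_height_fiber_add_le [IsProper f.left]
    [LocallyOfFiniteType S.hom] [IsSeparated S.hom] [LocallyOfFiniteType T.hom] {N : ℕ}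
    (ε : 𝒳 ⟶ projectiveSpace N ℂ) [IsPreimmersion ε.left] (H : IsPullback q g f h)
    {Z : Set 𝒲.left} (hZ : IsClosed Z) (p n : ℕ) :
    ∃ O : T.left.Opens, ∀ y : Motives.ComplexPoints T, y.pt ∈ (O : Set T.left) ↔
      ∀ z : (Motives.fiberOver g y).left, (Motives.fiberι g y).left.base z ∈ Z →
        height z + p ≤ (n : ℕ∞) := by
  classical
  -- ### the proper map `m = (q, g) : 𝒲 ⟶ 𝒳 × T` and the closed image of `Z`
  let m : 𝒲 ⟶ 𝒳 ⊗ T := lift q g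
  have hmfst : ∀ w, (fst 𝒳 T).left.base (m.left.base w) = q.left.base w := fun w => by
    change (m ≫ fst 𝒳 T).left.base w = _
    rw [lift_fst]
  have hmsnd : ∀ w, (snd 𝒳 T).left.base (m.left.base w) = g.left.base w := fun w => by
    change (m ≫ snd 𝒳 T).left.base w = _
    rw [lift_snd]
  haveI : IsSeparated 𝒳.hom := by rw [← Over.w f]; infer_instance
  haveI : IsSeparated (snd 𝒳 T).left := inferInstanceAs (IsSeparated (pullback.snd 𝒳.hom T.hom))
  have H' : IsPullback q.left g.left f.left h.left := H.map (Over.forget _)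
  haveI : IsProper g.left := MorphismProperty.of_isPullback (P := @IsProper) H' inferInstance
  haveI : IsProper (m.left ≫ (snd 𝒳 T).left) := by
    rw [← Over.comp_left, lift_snd]
    infer_instance
  haveI : IsProper m.left := IsProper.of_comp m.left (snd 𝒳 T).left
  let 𝒵 : Set (𝒳 ⊗ T).left := m.left.base '' Z
  have h𝒵 : IsClosed 𝒵 := m.left.isClosedMap _ hZ
  -- `H` on points
  have hHw : ∀ w, f.left.base (q.left.base w) = h.left.base (g.left.base w) := fun w => by
    have e := congrArg (fun φ => φ.left.base w) H.w
    simpa using e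
  -- slices of `𝒵` lie in the fibres
  have hgraph : ∀ (y : Motives.ComplexPoints T) (x : 𝒳.left), (sliceAt 𝒳 y).left.base x ∈ 𝒵 →
      f.left.base x = (AlgPoints.map h y).pt := by
    rintro y x ⟨w, hwZ, hw⟩
    rw [AlgPoints.pt_map, ← fst_sliceAt_base' y x, ← hw, hmfst, hHw, ← hmsnd, hw, snd_sliceAt_base]
  obtain ⟨O, hO⟩ := exists_opens_pt_mem_iff_forall_height_add_le f h ε h𝒵 hgraph p n
  refine ⟨O, fun y => (hO y).trans ?_⟩
  -- ### the fibre identification `𝒲_y ≅ 𝒳_{h y}` and heights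
  obtain ⟨φ, hφ⟩ := exists_fiberOver_iso_of_isPullback H y
  have hheight : ∀ z : (Motives.fiberOver g y).left,
      height (q.left.base ((Motives.fiberι g y).left.base z)) = height z := by
    intro z
    have e1 : q.left.base ((Motives.fiberι g y).left.base z) =
        (Motives.fiberι f (AlgPoints.map h y)).left.base (φ.hom.left.base z) := by
      change (Motives.fiberι g y ≫ q).left.base z = (φ.hom ≫ Motives.fiberι f (AlgPoints.map h y)).left.base z
      rw [hφ]
    haveI : IsIso φ.hom.left := (inferInstance : IsIso ((Over.forget _).mapIso φ).hom)
    rw [e1, height_fiberι_base_eq f, height_base_eq_of_isClosedImmersion' φ.hom.left z]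
  -- the slice of `𝒵` at `y` versus the slice of `Z`
  have hmι : ∀ z : (Motives.fiberOver g y).left,
      (sliceAt 𝒳 y).left.base (q.left.base ((Motives.fiberι g y).left.base z)) =
        m.left.base ((Motives.fiberι g y).left.base z) := by
    intro z
    obtain ⟨x, hx⟩ := exists_sliceAt_base_eq y (m.left.base ((Motives.fiberι g y).left.base z))
      (by rw [hmsnd, apply_fiberι_base_eq_pt'])
    have hx' : x = q.left.base ((Motives.fiberι g y).left.base z) := by
      rw [← fst_sliceAt_base' y x, hx, hmfst]
    rw [← hx', hx]
  constructor
  · intro hy z hz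
    rw [← hheight z]
    exact hy _ (by rw [hmι z]; exact ⟨_, hz, rfl⟩)
  · rintro hy x ⟨w, hwZ, hw⟩
    have hgw : g.left.base w = y.pt := by rw [← hmsnd, hw, snd_sliceAt_base]
    obtain ⟨z, rfl⟩ := exists_fiberι_base_eq g y w hgw
    have hx : x = q.left.base ((Motives.fiberι g y).left.base z) := by
      rw [← fst_sliceAt_base' y x, ← hw, hmfst]
    rw [hx, hheight z]
    exact hy z hwZ

/-! ### Transport along the fibre identifications -/

/-- **`(q^* A)|_{𝒲_y} = φ^*(A|_{𝒳_u})`** for a morphism of families `(q over h)` and an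
identification `φ : 𝒲_y ≅ 𝒳_u` of fibres compatible with the inclusions
(`φ ≫ ι_u = ι_y ≫ q`): functoriality of singular cohomology (Hatcher §3.1, induced
homomorphisms). [cite: HatcherAT2002, §3.1 (induced homomorphisms, p. 201)] -/
theorem map_fiberι_map_eq_map_of_fiberIso {y : Motives.ComplexPoints T} {u : Motives.ComplexPoints S}
    (φ : Motives.fiberOver g y ≅ Motives.fiberOver f u)
    (hφ : φ.hom ≫ Motives.fiberι f u = Motives.fiberι g y ≫ q) (i : ℕ) (A : complexBetti 𝒳 i) :
    complexBetti.map (Motives.fiberι g y) i (complexBetti.map q i A) =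
      complexBetti.map φ.hom i (complexBetti.map (Motives.fiberι f u) i A) := by
  rw [← CategoryTheory.comp_apply, ← complexBetti.map_comp, ← CategoryTheory.comp_apply,
    ← complexBetti.map_comp, hφ]

/-- **Death off the slice and codimension of the slice give algebraicity on the fibre of the
original family.** For a cartesian square `(q, g; f, h)`, a complex point `y` of `T` with
`𝒳_{h(y)}` smooth projective of dimension `n`, a closed `Z ⊆ 𝒲` and `A ∈ H²ᵖ(𝒳(ℂ); ℂ)`: if
`(q^* A)|_{𝒲_y}` dies off the slice `ι_y⁻¹ Z` and every point of the slice has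
`height + p ≤ n`, then `A|_{𝒳_{h(y)}} ∈ algebraicClasses`. (Transport along `𝒲_y ≅ 𝒳_{h(y)}`:
`dim + codim = n` on the smooth projective fibre, and `Nᵖ` is invariant under isomorphisms,
`mem_algebraicClasses_map_iff_of_iso`.) [cite: CharlesSchnell2014Notes, Prop. 11.3.11 (proof)]
[cite: GrothendieckTopology1969, §1] -/
theorem map_fiberι_mem_algebraicClasses_of_slice (H : IsPullback q g f h) {n p : ℕ}
    (y : Motives.ComplexPoints T)
    (hy : Motives.IsSmoothProjective n (Motives.fiberOver f (AlgPoints.map h y)))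
    {Z : Set 𝒲.left} (hZ : IsClosed Z) (A : complexBetti 𝒳 (2 * p))
    (hdeath : complexBetti.restrictCompl (Motives.fiberOver g y)
      ((Motives.fiberι g y).left.base ⁻¹' Z) (2 * p)
        (complexBetti.map (Motives.fiberι g y) (2 * p) (complexBetti.map q (2 * p) A)) = 0)
    (hcodim : ∀ z : (Motives.fiberOver g y).left, (Motives.fiberι g y).left.base z ∈ Z →
      height z + p ≤ (n : ℕ∞)) :
    complexBetti.map (Motives.fiberι f (AlgPoints.map h y)) (2 * p) A ∈
      algebraicClasses (Motives.fiberOver f (AlgPoints.map h y)) p := by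
  obtain ⟨φ, hφ⟩ := exists_fiberOver_iso_of_isPullback H y
  have hy' : Motives.IsSmoothProjective n (Motives.fiberOver g y) := hy.of_iso φ.symm
  have hmem : complexBetti.map (Motives.fiberι g y) (2 * p) (complexBetti.map q (2 * p) A) ∈
      algebraicClasses (Motives.fiberOver g y) p :=
    mem_supportedClasses_of_restrictCompl_eq_zero (hZ.preimage (Motives.fiberι g y).left.continuous)
      (fun z hz => (le_coheight_iff_height_add_le hy' z p).2 (hcodim z hz)) hdeath
  rw [map_fiberι_map_eq_map_of_fiberIso f q g φ hφ] at hmem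
  exact (mem_algebraicClasses_map_iff_of_iso φ).1 hmem

/-- **Death transports to the spread point**: for an identification `e : 𝒲_t ≅ 𝒳_s` of fibres
compatible with the inclusions and carrying the slice `ι_t⁻¹ Z` onto `V`, if `A|_{𝒳_s}` dies off
`V` then `(q^* A)|_{𝒲_t}` dies off the slice (functoriality of the restriction maps in singular
cohomology, Hatcher §3.1; the step "the class vanishes off the spread support at the very general
point" of Charles–Schnell, proof of Prop. 11.3.11). [cite: HatcherAT2002, §3.1 (induced homomorphisms, p. 201)]
[cite: CharlesSchnell2014Notes, Prop. 11.3.11 (proof)] -/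
theorem restrictCompl_map_fiberι_map_eq_zero_of_fiberIso {t : Motives.ComplexPoints T}
    {s : Motives.ComplexPoints S} (e : Motives.fiberOver g t ≅ Motives.fiberOver f s)
    (hcomp : e.hom ≫ Motives.fiberι f s = Motives.fiberι g t ≫ q) {Z : Set 𝒲.left}
    {V : Set (Motives.fiberOver f s).left}
    (hslice : e.hom.left.base ⁻¹' V = (Motives.fiberι g t).left.base ⁻¹' Z) {i : ℕ}
    (A : complexBetti 𝒳 i)
    (hV : complexBetti.restrictCompl (Motives.fiberOver f s) V i
      (complexBetti.map (Motives.fiberι f s) i A) = 0) :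
    complexBetti.restrictCompl (Motives.fiberOver g t) ((Motives.fiberι g t).left.base ⁻¹' Z) i
      (complexBetti.map (Motives.fiberι g t) i (complexBetti.map q i A)) = 0 := by
  rw [map_fiberι_map_eq_map_of_fiberIso f q g e hcomp, ← hslice]
  exact complexBetti.restrictCompl_map_eq_zero e.hom hV

/-- **Codimension transports to the spread point**: with `e : 𝒲_t ≅ 𝒳_s` carrying the slice
`ι_t⁻¹ Z` onto `V ⊆ 𝒳_s` (`𝒳_s` smooth projective of dimension `n`), if every point of `V` has
codimension `≥ p` then every point of the slice has `height + p ≤ n`. [cite: Hartshorne1977, II Ex. 3.20 (d)] -/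
theorem forall_height_add_le_of_fiberIso {n p : ℕ} {t : Motives.ComplexPoints T}
    {s : Motives.ComplexPoints S} (hs : Motives.IsSmoothProjective n (Motives.fiberOver f s))
    (e : Motives.fiberOver g t ≅ Motives.fiberOver f s) {Z : Set 𝒲.left}
    {V : Set (Motives.fiberOver f s).left}
    (hslice : e.hom.left.base ⁻¹' V = (Motives.fiberι g t).left.base ⁻¹' Z)
    (hV : ∀ v ∈ V, (p : ℕ∞) ≤ coheight v) (z : (Motives.fiberOver g t).left)
    (hz : (Motives.fiberι g t).left.base z ∈ Z) : height z + p ≤ (n : ℕ∞) := by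
  have hz' : e.hom.left.base z ∈ V := by
    have : z ∈ e.hom.left.base ⁻¹' V := by rw [hslice]; exact hz
    exact this
  have ht : Motives.IsSmoothProjective n (Motives.fiberOver g t) := hs.of_iso e.symm
  rw [← le_coheight_iff_height_add_le ht z p, ← coheight_left_base_eq_of_iso e z]
  exact hV _ hz'

end HodgeTheory

end Literature.AlgebraicGeometry.HodgeTheory

end
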